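import Mathlib
import Summits.Schanuel.Schanuel.Theses.SingularModulusScaling
import Summits.Schanuel.Schanuel.Theses.GaussianStokesSector

/-!
# Birth skeleton (BC3) for crux `PiFreeOverLWField` (item stmt-Schanuel-9545,
route `SingularModulusScaling`)

Seat `planner-skel-stmt-Schanuel-9545-0` (skeleton-register one-shot; route re-audit bin
REPAIRABLE), 2026-08-17. The crux
`Summit.Schanuel.Schanuel.Theses.SingularModulusScaling.PiFreeOverLWField` is the π–LW SECTOR of
Schanuel's conjecture: for `ℚ`-linearly independent algebraic `a₁, …, a_d`,
`d + 1 ≤ trdeg_ℚ ℚ(π, e^{a₁}, …, e^{a_d})` ("π is transcendental over the Lindemann–Weierstrass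
field"; `d = 0` Lindemann, `d = 1 ∋ e ⊥ π`; Gel'fond's conjecture, Waldschmidt 1974 LNM 402 §7.5
Conj. 7.5.3 with `m = 1`, `ℓ₁ = πi`). The item is shared verbatim by routes ExceptionalSubspaces
(rank 2), GaussianStokesSector (rank 5) and SingularModulusScaling (rank 6); this skeleton is the
LINE OF ROUTE `SingularModulusScaling` (its thesis: "π is a universal CM period — scale the
singular modulus `k_r → 0`, keep `e^α` fixed"), i.e. the route's glue support
`PiFreeOfCMFreeness` (stmt-Schanuel-17195: `CMBoundedDegreeFreeness → SingularModulusExists →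
SingularValuesAlgebraic → PiFreeOverLWField`, "provable now") actually PROVED, with the three
antecedents as the registered stubs. The crux is concluded BY NAME (`PiFreeOverLWField_of`,
sorry-free; `PiFreeOverLWField_proof` plugs the sorried stubs in; `piFreeOfCMFreeness` is the
support item by name, axioms `[propext, Classical.choice, Quot.sound]`;
`PiFreeOverLWField_ofGaussianStokesSector` / `PiFreeOverLWField_proofGaussianStokesSector`
conclude the byte-identical decl of the sibling route GaussianStokesSector; the third copy,
`ExceptionalSubspaces.PiFreeOverLWField` (same body), follows verbatim by
`fun d a ha hli => PiFreeOverLWField_of hCM hE hA d a ha hli` once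
`Summits.Schanuel.Schanuel.Theses.ExceptionalSubspaces` is imported — left out here only because
that module was incoherent on the farm at publication time, 2026-08-17).

Notation: `F(t) = Σₙ (C(2n,n)/4ⁿ)² tⁿ = ₂F₁(½,½;1;t)`, `G(t) = Σₙ −(C(2n,n)/4ⁿ)²/(2n−1) · tⁿ =
₂F₁(−½,½;1;t)` (so `K(k) = (π/2)F(k²)`, `E(k) = (π/2)G(k²)`), inlined as `tsum`s exactly as in
the route file; the singular modulus of degree `r` is the `t = t_r ∈ (0,1)` with
`F(1 − t) = √r · F(t)`.

* `stub_cmBoundedDegreeFreeness` (OPEN — the ENGINE OUTPUT; = route crux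
  `CMBoundedDegreeFreeness`, stmt-Schanuel-17191, rank 2, byte-identical body): for `ℚ`-free
  algebraic `a` and every degree bound `δ` there is `r₀` such that for all `r ≥ r₀`, at the
  singular modulus `t` of degree `r`, NO nonzero `P ∈ ℂ[X₁..X_d, Y, Z]` with algebraic
  coefficients and `deg P ≤ δ` vanishes at `(e^{a₁}, …, e^{a_d}, F(t), G(t))` (the output shape
  of a mixed E⊠G Bombieri "global relations" theorem along the CM family; `d = 0` is
  G. Chudnovsky's `π ⊥ K(k_r)`). The load-bearing stub.
* `stub_singularModulusExists` (PROVABLE NOW, size M; = route support `SingularModulusExists`,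
  stmt-Schanuel-17193, byte-identical): for `r ≥ 1` some `t ∈ (0,1)` has `F(1−t) = √r F(t)`
  (intermediate value theorem: `F(1−t)/F(t)` decreases from `+∞` to `0` on `(0,1)`).
* `stub_singularValuesAlgebraic` (a PRINTED THEOREM, size L; = route support
  `SingularValuesAlgebraic`, stmt-Schanuel-17194, byte-identical): at such `t`, `t` is algebraic
  (Abel–Kronecker–Weber) and `α(r) := (1/π − √r(F G − F²))/F²` is algebraic (the
  Ramanujan–Borwein singular value function; Borwein–Borwein 1987 Ch. 5, from Legendre's relation
  and the CM values of `E₂*`).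
* `PiFreeOverLWField_of` — REAL PROOF (the support item `PiFreeOfCMFreeness` made formal):
  if `¬ (d + 1 ≤ trdeg ℚ(π, e^a))`, the tuple `(e^a, π)` is algebraically dependent
  (`exists_relation_of_not_le`: else `#(Fin d ⊕ Fin 1) ≤ trdeg` by
  `AlgebraicIndependent.cardinalMk_le_trdeg`), giving `P₀ ≠ 0` in `ℚ[X, Y]` with
  `P₀(e^a, π) = 0`; take `δ = 3 · deg P₀`, `r₀` from stub 1, `r = max r₀ 1`, `t` from stub 2,
  `α(r)` algebraic from stub 3; `F(t) ≥ 1` (`one_le_F`, comparison with the geometric series via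
  `Nat.centralBinom_le_four_pow`), so Legendre's relation in Ramanujan–Borwein form
  `π · L_r(F, G) = 1`, `L_r(Y, Z) = α(r) Y² + √r (YZ − Y²)`, holds BY DEFINITION of `α(r)`;
  `transfer` then builds `Q = Σ_{s ∈ supp P₀} c_s X^{s_X} L_r^{m − s_Y}` (`m = deg_Y P₀`) over the
  field of algebraic numbers `algebraicClosure ℚ ℂ` and maps it to `ℂ`: `Q ≠ 0` (killing `Y, Z`
  leaves the top `Y`-coefficient of `P₀`), coefficients algebraic (`coeff_map`), `deg Q ≤ 3 deg P₀`,
  and `Q(e^a, F, G) = L_r(F,G)^m · P₀(e^a, π) = 0` — contradicting stub 1 at `r`.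

The cut is genuine (no shredding / costume): stub 1 is an OPEN freeness statement about VALUES OF
G-FUNCTIONS AT CM POINTS that never mentions `π` (strictly different object from the crux; it
implies the crux only through the universal-period identity supplied by stubs 2–3 and the
`δ`-uniform accumulation proved here), stub 2 is real analysis, stub 3 a printed CM theorem; none
is the crux or the summit reworded (BC3 probes below), and the composition carries real content
(≈ 200 lines: dependence extraction, the inverted-quadratic-form transfer, degree and
non-vanishing bookkeeping).

Disproof used: none on file — `ledger crux ls stmt-Schanuel-9545` (2026-08-17): "(no workfiles
yet)", no `Disproof.lean`, no landed `Theorems/PiFreeOverLWField/Negative/*`. Negatives index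
(`ledger negatives --problem Schanuel`, 2026-08-17): 2 entries (`PolarPhantomsPhantomsAreTraceless_refuted`,
`PolarPhantomsPolarSchanuel_refuted`, both `¬ ∀ n y α, … trdeg ℚ(y, α) < n` phantom statements) —
unrelated to singular moduli / G-values; no stub is an instance of either.

BC3 probes (planner folder `bc/stub_<name>_probe_{crux,summit}.lean`, importing only Mathlib and
the route file, the stub restated verbatim as `def Stub : Prop`; `lean check` 2026-08-17, rc 1
each, `set_option maxHeartbeats 400000` per example): for EACH of the three stubs,
`Stub → PiFreeOverLWField` and `Stub → _root_.Schanuel` by `first | exact? | simpa | aesop` and by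
`first | exact? | simpa [Stub, C] | (unfold Stub C; simpa) | aesop` FAIL, and the per-tactic
variants `exact?` / `simpa` / `simpa [Stub, C]` / `unfold Stub C; simpa` / `aesop` /
`intro h; exact?` each FAIL on their own (crux target: `exact?` hits the heartbeat limit at
`whnf`, `simpa` "assumption failed", `aesop` "failed after exhaustive search"; summit target:
`exact?` "could not close the goal", `simpa` failed, `aesop` exhaustive search failed), and
`Stub` itself by `first | exact? | simp [Stub] | aesop` FAILS — 51/51 probes fail: no stub is
cheaply the crux, the summit, or a tree one-liner.
-/

noncomputable section

set_option linter.dupNamespace false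

namespace Summit.Schanuel.Schanuel.Cruxes.PiFreeOverLWField.Birth

open Summit.Schanuel.Schanuel.Theses.SingularModulusScaling
  (CMBoundedDegreeFreeness SingularModulusExists SingularValuesAlgebraic PiFreeOverLWField
    PiFreeOfCMFreeness)
open MvPolynomial

/-! ### Registered stubs -/

/-- STUB 1 (OPEN — the ENGINE OUTPUT; = route crux `CMBoundedDegreeFreeness`,
stmt-Schanuel-17191, rank 2, byte-identical body): for every `d`, every `ℚ`-linearly independent
family of algebraic numbers `a₁, …, a_d` and every degree bound `δ` there is `r₀` such that for
every `r ≥ r₀` and every `t ∈ (0,1)` with `F(1−t) = √r F(t)` (the singular modulus of degree `r`),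
no nonzero `P ∈ ℂ[X₁..X_d, Y, Z]` of total degree `≤ δ` with algebraic coefficients vanishes at
`(e^{a₁}, …, e^{a_d}, F(t), G(t))`. The output shape of a mixed E⊠G Bombieri "global relations
are functional" theorem along the CM family; `d = 0` true for every `r` (G. Chudnovsky,
`π ⊥ K(k_r)`). Why it might fail: implied by period conjectures but by no printed theorem; the
engine needs Galois-covariance of the Ramanujan–Borwein identities over the ring class field and
a two-variable zero estimate. [cite: Chudnovsky1984; Andre1989 Ch. VII; Bombieri1981;
arXiv:2510.11814; BorweinBorwein1987 Ch. 5] -/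
theorem stub_cmBoundedDegreeFreeness :
    ∀ (d : ℕ) (a : Fin d → ℂ), (∀ i, IsAlgebraic ℚ (a i)) → LinearIndependent ℚ a → ∀ δ : ℕ,
      ∃ r₀ : ℕ, ∀ r : ℕ, r₀ ≤ r → ∀ t : ℝ, 0 < t → t < 1 →
        (∑' n : ℕ, ((Nat.centralBinom n : ℝ) / 4 ^ n) ^ 2 * (1 - t) ^ n) =
          Real.sqrt r * ∑' n : ℕ, ((Nat.centralBinom n : ℝ) / 4 ^ n) ^ 2 * t ^ n →
        ∀ P : MvPolynomial (Fin d ⊕ Fin 2) ℂ, P ≠ 0 → (∀ m, IsAlgebraic ℚ (P.coeff m)) →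
          P.totalDegree ≤ δ →
            MvPolynomial.eval (Sum.elim (Complex.exp ∘ a)
              ![((∑' n : ℕ, ((Nat.centralBinom n : ℝ) / 4 ^ n) ^ 2 * t ^ n : ℝ) : ℂ),
                ((∑' n : ℕ, -(((Nat.centralBinom n : ℝ) / 4 ^ n) ^ 2 / (2 * (n : ℝ) - 1)) *
                  t ^ n : ℝ) : ℂ)]) P ≠ 0 := by
  sorry

/-- STUB 2 (PROVABLE NOW, size M; = route support `SingularModulusExists`, stmt-Schanuel-17193,
byte-identical body): for every integer `r ≥ 1` there is `t ∈ (0,1)` with `F(1−t) = √r · F(t)`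
(the singular modulus `k_r²`: `F` is continuous and increasing on `[0,1)` with `F(t) → ∞` as
`t → 1⁻`, so `F(1−t)/F(t)` decreases continuously from `+∞` to `0`; intermediate value theorem).
[cite: BorweinBorwein1987 Ch. 1–2; Mathlib `Nat.centralBinom`] -/
theorem stub_singularModulusExists :
    ∀ r : ℕ, 1 ≤ r → ∃ t : ℝ, 0 < t ∧ t < 1 ∧
      (∑' n : ℕ, ((Nat.centralBinom n : ℝ) / 4 ^ n) ^ 2 * (1 - t) ^ n) =
        Real.sqrt r * ∑' n : ℕ, ((Nat.centralBinom n : ℝ) / 4 ^ n) ^ 2 * t ^ n := by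
  sorry

/-- STUB 3 (a PRINTED THEOREM, size L; = route support `SingularValuesAlgebraic`,
stmt-Schanuel-17194, byte-identical body): for `r ≥ 1` and `t ∈ (0,1)` with `F(1−t) = √r F(t)`,
`t` is algebraic (Abel–Kronecker–Weber: singular moduli are algebraic) and
`α(r) := (1/π − √r (F(t)G(t) − F(t)²)) / F(t)²` is algebraic (the Ramanujan–Borwein singular value
function `α(r) = E′/K − π/(4K²)`, algebraic for rational `r > 0`; from Legendre's relation
`EK′ + E′K − KK′ = π/2` with `K′ = √r K` and the algebraicity of the CM values of the
non-holomorphic `E₂*`). [cite: BorweinBorwein1987 Ch. 5 (Thm 5.1ff); Masser1975;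
Chudnovsky1988Ramanujan; Shimura1975Arith] -/
theorem stub_singularValuesAlgebraic :
    ∀ r : ℕ, 1 ≤ r → ∀ t : ℝ, 0 < t → t < 1 →
      (∑' n : ℕ, ((Nat.centralBinom n : ℝ) / 4 ^ n) ^ 2 * (1 - t) ^ n) =
        Real.sqrt r * ∑' n : ℕ, ((Nat.centralBinom n : ℝ) / 4 ^ n) ^ 2 * t ^ n →
      IsAlgebraic ℚ t ∧
        IsAlgebraic ℚ ((1 / Real.pi - Real.sqrt r *
          ((∑' n : ℕ, ((Nat.centralBinom n : ℝ) / 4 ^ n) ^ 2 * t ^ n) *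
            (∑' n : ℕ, -(((Nat.centralBinom n : ℝ) / 4 ^ n) ^ 2 / (2 * (n : ℝ) - 1)) * t ^ n) -
            (∑' n : ℕ, ((Nat.centralBinom n : ℝ) / 4 ^ n) ^ 2 * t ^ n) ^ 2)) /
          (∑' n : ℕ, ((Nat.centralBinom n : ℝ) / 4 ^ n) ^ 2 * t ^ n) ^ 2) := by
  sorry

/-! ### Stub statements by name -/

namespace Statement

/-- Statement of `stub_cmBoundedDegreeFreeness`. -/
abbrev stub_cmBoundedDegreeFreeness : Prop := type_of% @Birth.stub_cmBoundedDegreeFreeness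
/-- Statement of `stub_singularModulusExists`. -/
abbrev stub_singularModulusExists : Prop := type_of% @Birth.stub_singularModulusExists
/-- Statement of `stub_singularValuesAlgebraic`. -/
abbrev stub_singularValuesAlgebraic : Prop := type_of% @Birth.stub_singularValuesAlgebraic

end Statement

/-! ### Calibration: the stubs are the route decls verbatim -/

example : Statement.stub_cmBoundedDegreeFreeness ↔ CMBoundedDegreeFreeness := Iff.rfl
example : Statement.stub_singularModulusExists ↔ SingularModulusExists := Iff.rfl
example : Statement.stub_singularValuesAlgebraic ↔ SingularValuesAlgebraic := Iff.rfl

/-! ### Glue lemmas (sorry-free) -/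

/-- The hypergeometric series `F(t) = Σ (C(2n,n)/4ⁿ)² tⁿ` converges on `[0,1)` (comparison with
the geometric series, `C(2n,n) ≤ 4ⁿ`). [folklore] -/
theorem summable_F {t : ℝ} (ht0 : 0 ≤ t) (ht1 : t < 1) :
    Summable (fun n : ℕ => ((Nat.centralBinom n : ℝ) / 4 ^ n) ^ 2 * t ^ n) := by
  refine Summable.of_nonneg_of_le (fun n => by positivity) (fun n => ?_)
    (summable_geometric_of_lt_one ht0 ht1)
  have h1 : ((Nat.centralBinom n : ℝ) / 4 ^ n) ≤ 1 := by
    rw [div_le_one (by positivity)]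
    exact_mod_cast Nat.centralBinom_le_four_pow n
  have h0 : (0 : ℝ) ≤ (Nat.centralBinom n : ℝ) / 4 ^ n := by positivity
  calc ((Nat.centralBinom n : ℝ) / 4 ^ n) ^ 2 * t ^ n ≤ 1 ^ 2 * t ^ n := by gcongr
    _ = t ^ n := by rw [one_pow, one_mul]

/-- `F(t) ≥ 1` on `[0,1)` (its constant term is `1` and all terms are nonnegative). [folklore] -/
theorem one_le_F {t : ℝ} (ht0 : 0 ≤ t) (ht1 : t < 1) :
    1 ≤ ∑' n : ℕ, ((Nat.centralBinom n : ℝ) / 4 ^ n) ^ 2 * t ^ n := by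
  have h := (summable_F ht0 ht1).le_tsum 0 (fun j _ => by positivity)
  simpa using h

/-- Keep the `X`-exponents of a monomial of `ℚ[X₁..X_d, Y]`, drop the `Y`-exponent, and read the
result as an exponent vector of `ℂ[X₁..X_d, Y, Z]`. -/
def hat {d : ℕ} (s : (Fin d ⊕ Fin 1) →₀ ℕ) : (Fin d ⊕ Fin 2) →₀ ℕ :=
  Finsupp.equivFunOnFinite.symm (Sum.elim (fun i => s (Sum.inl i)) fun _ => 0)

@[simp] theorem hat_inl {d : ℕ} (s : (Fin d ⊕ Fin 1) →₀ ℕ) (i : Fin d) :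
    hat s (Sum.inl i) = s (Sum.inl i) := rfl

@[simp] theorem hat_inr {d : ℕ} (s : (Fin d ⊕ Fin 1) →₀ ℕ) (j : Fin 2) :
    hat s (Sum.inr j) = 0 := rfl

/-- **Transfer of a relation through the inverted quadratic form** (the algebra of
`PiFreeOfCMFreeness`): if `P₀(x, y) = 0` for a nonzero `P₀ ∈ ℚ[X₁..X_d, Y]` and
`y · L(u, v) = 1` with `L(Y, Z) = α Y² + β (YZ − Y²)`, `α, β` algebraic, then
`Q := Σₛ c_s X^{s_X} L^{m − s_Y}` (`m = deg_Y P₀`) is a nonzero polynomial with algebraic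
coefficients, of total degree `≤ 3 deg P₀`, vanishing at `(x, u, v)`. [folklore] -/
theorem transfer {d : ℕ} (x : Fin d → ℂ) (y u v α β : ℂ) (hα : IsAlgebraic ℚ α)
    (hβ : IsAlgebraic ℚ β) (hy : y * (α * u ^ 2 + β * (u * v - u ^ 2)) = 1)
    (P₀ : MvPolynomial (Fin d ⊕ Fin 1) ℚ) (hP₀ : P₀ ≠ 0)
    (hrel : MvPolynomial.aeval (Sum.elim x fun _ => y) P₀ = 0) :
    ∃ Q : MvPolynomial (Fin d ⊕ Fin 2) ℂ, Q ≠ 0 ∧ (∀ m, IsAlgebraic ℚ (Q.coeff m)) ∧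
      Q.totalDegree ≤ 3 * P₀.totalDegree ∧ MvPolynomial.eval (Sum.elim x ![u, v]) Q = 0 := by
  classical
  -- the field of algebraic numbers inside `ℂ`
  set A : IntermediateField ℚ ℂ := algebraicClosure ℚ ℂ with hAdef
  have hinj : Function.Injective (algebraMap A ℂ) := (algebraMap A ℂ).injective
  have hinjQ : Function.Injective (algebraMap ℚ A) := (algebraMap ℚ A).injective
  set α' : A := ⟨α, mem_algebraicClosure_iff.2 hα⟩ with hα'
  set β' : A := ⟨β, mem_algebraicClosure_iff.2 hβ⟩ with hβ'
  -- the quadratic form `L(Y, Z) = α Y² + β (YZ − Y²)`, `Y = X (inr 0)`, `Z = X (inr 1)`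
  set L : MvPolynomial (Fin d ⊕ Fin 2) A :=
    C α' * X (Sum.inr 0) ^ 2 + C β' * (X (Sum.inr 0) * X (Sum.inr 1) - X (Sum.inr 0) ^ 2)
    with hLdef
  -- the `Y`-degree of `P₀`
  set m : ℕ := P₀.degreeOf (Sum.inr 0) with hmdef
  have hkm : ∀ s ∈ P₀.support, s (Sum.inr 0) ≤ m := fun s hs =>
    monomial_le_degreeOf (Sum.inr 0) hs
  -- the transferred polynomial, over `A`
  set Q₀ : MvPolynomial (Fin d ⊕ Fin 2) A :=
    ∑ s ∈ P₀.support, monomial (hat s) (algebraMap ℚ A (P₀.coeff s)) * L ^ (m - s (Sum.inr 0))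
    with hQ₀def
  refine ⟨MvPolynomial.map (algebraMap A ℂ) Q₀, ?_, ?_, ?_, ?_⟩
  · -- (1) `Q ≠ 0`: kill `Y, Z`; what survives is the top `Y`-coefficient of `P₀`
    intro hQ
    have hQ₀ : Q₀ = 0 := map_injective _ hinj (by rw [hQ, map_zero])
    set ψ : MvPolynomial (Fin d ⊕ Fin 2) A →ₐ[A] MvPolynomial (Fin d ⊕ Fin 2) A :=
      aeval (Sum.elim (fun i => (X (Sum.inl i) : MvPolynomial (Fin d ⊕ Fin 2) A)) fun _ => 0)
      with hψdef
    have hψL : ψ L = 0 := by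
      simp [hψdef, hLdef, map_add, map_mul, map_sub, map_pow]
    have hψmon : ∀ (s : (Fin d ⊕ Fin 1) →₀ ℕ) (c : A),
        ψ (monomial (hat s) c) = monomial (hat s) c := by
      intro s c
      rw [hψdef, aeval_monomial, Finsupp.prod_fintype _ _ (fun _ => pow_zero _),
        Fintype.prod_sum_type, monomial_eq, Finsupp.prod_fintype _ _ (fun _ => pow_zero _),
        Fintype.prod_sum_type]
      simp [algebraMap_eq]
    obtain ⟨s₀, hs₀, hs₀m⟩ : ∃ s₀ ∈ P₀.support, s₀ (Sum.inr 0) = m := by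
      obtain ⟨s₀, hs₀, h⟩ := Finset.exists_mem_eq_sup P₀.support (support_nonempty.2 hP₀)
        (fun s => s (Sum.inr 0))
      exact ⟨s₀, hs₀, by rw [hmdef, degreeOf_eq_sup, h]⟩
    have hψQ : ψ Q₀ = ∑ s ∈ P₀.support.filter (fun s => s (Sum.inr 0) = m),
        monomial (hat s) (algebraMap ℚ A (P₀.coeff s)) := by
      rw [Finset.sum_filter, hQ₀def, map_sum]
      refine Finset.sum_congr rfl fun s hs => ?_
      rw [map_mul, map_pow, hψL, hψmon]
      by_cases h : s (Sum.inr 0) = m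
      · simp [h]
      · have hne : m - s (Sum.inr 0) ≠ 0 := by have := hkm s hs; omega
        simp [h, zero_pow hne]
    have hcoeff : (ψ Q₀).coeff (hat s₀) = algebraMap ℚ A (P₀.coeff s₀) := by
      rw [hψQ, coeff_sum, Finset.sum_eq_single_of_mem s₀ (Finset.mem_filter.2 ⟨hs₀, hs₀m⟩)]
      · simp
      · intro s hs hne
        rw [coeff_monomial, if_neg]
        intro heq
        apply hne
        ext j
        rcases j with i | j
        · simpa using congrArg (fun f : (Fin d ⊕ Fin 2) →₀ ℕ => f (Sum.inl i)) heq
        · have hj : j = 0 := Subsingleton.elim _ _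
          subst hj
          rw [(Finset.mem_filter.1 hs).2, hs₀m]
    have h0 : (ψ Q₀).coeff (hat s₀) = 0 := by rw [hQ₀, map_zero, coeff_zero]
    rw [hcoeff] at h0
    exact (mem_support_iff.1 hs₀) (hinjQ (by rw [h0, map_zero]))
  · -- (2) the coefficients of `Q` are algebraic
    intro n
    rw [coeff_map]
    exact mem_algebraicClosure_iff.1 (Q₀.coeff n).2
  · -- (3) `deg Q ≤ 3 deg P₀`
    have hsupp : (MvPolynomial.map (algebraMap A ℂ) Q₀).totalDegree = Q₀.totalDegree := by
      rw [totalDegree, support_map_of_injective _ hinj, totalDegree]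
    rw [hsupp, hQ₀def]
    have hL : L.totalDegree ≤ 2 := by
      rw [hLdef]
      refine (totalDegree_add _ _).trans (max_le ?_ ?_)
      · refine (totalDegree_mul _ _).trans ?_
        rw [totalDegree_C, totalDegree_X_pow]
      · refine (totalDegree_mul _ _).trans ?_
        rw [totalDegree_C, zero_add]
        refine (totalDegree_sub _ _).trans (max_le ?_ ?_)
        · refine (totalDegree_mul _ _).trans ?_
          rw [totalDegree_X, totalDegree_X]
        · rw [totalDegree_X_pow]
    have hm : m ≤ P₀.totalDegree := degreeOf_le_totalDegree P₀ (Sum.inr 0)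
    refine totalDegree_finsetSum_le fun s hs => ?_
    have h1 : (monomial (hat s) (algebraMap ℚ A (P₀.coeff s))).totalDegree ≤ P₀.totalDegree := by
      refine (totalDegree_monomial_le _ _).trans ?_
      have e1 : ((hat s).sum fun _ => id) = ∑ i : Fin d, s (Sum.inl i) := by
        rw [Finsupp.sum_fintype _ _ (fun _ => rfl), Fintype.sum_sum_type]
        simp
      have e2 : (s.sum fun _ e => e) = ∑ i : Fin d, s (Sum.inl i) + ∑ j : Fin 1, s (Sum.inr j) := by
        rw [Finsupp.sum_fintype _ _ (fun _ => rfl), Fintype.sum_sum_type]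
      have e3 := le_totalDegree hs
      rw [e1]
      rw [e2] at e3
      omega
    have h2 : (L ^ (m - s (Sum.inr 0))).totalDegree ≤ (m - s (Sum.inr 0)) * 2 :=
      (totalDegree_pow _ _).trans (Nat.mul_le_mul_left _ hL)
    refine (totalDegree_mul _ _).trans ?_
    have h3 : (m - s (Sum.inr 0)) * 2 ≤ 2 * P₀.totalDegree := by omega
    omega
  · -- (4) `Q(x, u, v) = L(u,v)^m · P₀(x, y) = 0`
    rw [eval_map]
    set w : Fin d ⊕ Fin 2 → ℂ := Sum.elim x ![u, v] with hwdef
    set ℓ : ℂ := α * u ^ 2 + β * (u * v - u ^ 2) with hℓdef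
    have hL : eval₂ (algebraMap A ℂ) w L = ℓ := by
      simp only [hLdef, eval₂_add, eval₂_mul, eval₂_sub, eval₂_pow, eval₂_C, eval₂_X, hwdef,
        Sum.elim_inr, Matrix.cons_val_zero, Matrix.cons_val_one, hℓdef]
      rfl
    have hmon : ∀ (s : (Fin d ⊕ Fin 1) →₀ ℕ) (c : A), eval₂ (algebraMap A ℂ) w (monomial (hat s) c)
        = algebraMap A ℂ c * ∏ i : Fin d, x i ^ s (Sum.inl i) := by
      intro s c
      rw [eval₂_monomial, Finsupp.prod_fintype _ _ (fun _ => pow_zero _), Fintype.prod_sum_type]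
      simp [hwdef]
    have hrel' : ∑ s ∈ P₀.support, algebraMap ℚ ℂ (P₀.coeff s) *
        ((∏ i : Fin d, x i ^ s (Sum.inl i)) * y ^ s (Sum.inr 0)) = 0 := by
      rw [MvPolynomial.aeval_def, eval₂_eq'] at hrel
      rw [← hrel]
      refine Finset.sum_congr rfl fun s hs => ?_
      rw [Fintype.prod_sum_type, Fin.prod_univ_one]
      simp
    have hpow : ∀ k ≤ m, ℓ ^ (m - k) = ℓ ^ m * y ^ k := by
      intro k hk
      calc ℓ ^ (m - k) = ℓ ^ (m - k) * (y * ℓ) ^ k := by rw [hy, one_pow, mul_one]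
        _ = (ℓ ^ (m - k) * ℓ ^ k) * y ^ k := by rw [mul_pow]; ring
        _ = ℓ ^ m * y ^ k := by rw [← pow_add, Nat.sub_add_cancel hk]
    have halg : ∀ q : ℚ, algebraMap A ℂ (algebraMap ℚ A q) = algebraMap ℚ ℂ q := fun q =>
      (IsScalarTower.algebraMap_apply ℚ A ℂ q).symm
    rw [hQ₀def, eval₂_sum]
    calc ∑ s ∈ P₀.support, eval₂ (algebraMap A ℂ) w
          (monomial (hat s) (algebraMap ℚ A (P₀.coeff s)) * L ^ (m - s (Sum.inr 0)))
        = ∑ s ∈ P₀.support, ℓ ^ m * (algebraMap ℚ ℂ (P₀.coeff s) *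
            ((∏ i : Fin d, x i ^ s (Sum.inl i)) * y ^ s (Sum.inr 0))) := by
          refine Finset.sum_congr rfl fun s hs => ?_
          rw [eval₂_mul, eval₂_pow, hmon, hL, halg, hpow _ (hkm s hs)]
          ring
      _ = 0 := by rw [← Finset.mul_sum, hrel', mul_zero]

/-- **Algebraic dependence from a transcendence-degree defect.** If
`trdeg_ℚ ℚ(π, e^{a₁}, …, e^{a_d}) ≱ d + 1`, then `(e^{a₁}, …, e^{a_d}, π)` satisfies a nonzero
polynomial relation over `ℚ`. [folklore] -/
theorem exists_relation_of_not_le {d : ℕ} (a : Fin d → ℂ)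
    (h : ¬ ((d + 1 : ℕ) : Cardinal) ≤ Algebra.trdeg ℚ
      ↥(IntermediateField.adjoin ℚ (insert (Real.pi : ℂ) (Set.range (Complex.exp ∘ a))))) :
    ∃ P₀ : MvPolynomial (Fin d ⊕ Fin 1) ℚ, P₀ ≠ 0 ∧
      MvPolynomial.aeval (Sum.elim (Complex.exp ∘ a) fun _ => (Real.pi : ℂ)) P₀ = 0 := by
  classical
  set K := IntermediateField.adjoin ℚ (insert (Real.pi : ℂ) (Set.range (Complex.exp ∘ a)))
    with hKdef
  set v : Fin d ⊕ Fin 1 → ℂ := Sum.elim (Complex.exp ∘ a) fun _ => (Real.pi : ℂ) with hvdef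
  have hvK : ∀ j, v j ∈ K := by
    rintro (i | j)
    · exact IntermediateField.subset_adjoin ℚ _ (Set.mem_insert_of_mem _ ⟨i, rfl⟩)
    · exact IntermediateField.subset_adjoin ℚ _ (Set.mem_insert _ _)
  have hdep : ¬ AlgebraicIndependent ℚ v := by
    intro hind
    have hind' : AlgebraicIndependent ℚ (fun j => (⟨v j, hvK j⟩ : K)) :=
      AlgebraicIndependent.of_comp K.val hind
    have hle := hind'.cardinalMk_le_trdeg
    have hcard : Cardinal.mk (Fin d ⊕ Fin 1) = ((d + 1 : ℕ) : Cardinal) := by simp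
    rw [hcard] at hle
    exact h hle
  rw [algebraicIndependent_iff] at hdep
  push Not at hdep
  obtain ⟨P₀, h1, h2⟩ := hdep
  exact ⟨P₀, h2, h1⟩

/-! ### The crux from the stubs (kernel-checked composition, no `sorry`) -/

/-- **`PiFreeOverLWField` BY NAME from the three stub statements** — the route's support item
`PiFreeOfCMFreeness` (stmt-Schanuel-17195) made formal: if `trdeg ℚ(π, e^a) ≤ d`, a nonzero
`P₀ ∈ ℚ[X, Y]` kills `(e^a, π)`; for `δ = 3 deg P₀` the engine (stub 1) gives `r₀`; at
`r = max r₀ 1` stub 2 gives the singular modulus `t`, stub 3 makes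
`α(r) = (1/π − √r(FG − F²))/F²` algebraic (`F = F(t) ≥ 1`), so `π · L_r(F, G) = 1` with
`L_r(Y, Z) = α(r)Y² + √r(YZ − Y²)`; `transfer` produces a nonzero `Q` with algebraic
coefficients, `deg Q ≤ δ`, `Q(e^a, F, G) = 0` — contradicting stub 1 at `r`. [folklore] -/
theorem PiFreeOverLWField_of (hCM : Statement.stub_cmBoundedDegreeFreeness)
    (hE : Statement.stub_singularModulusExists) (hA : Statement.stub_singularValuesAlgebraic) :
    PiFreeOverLWField := by
  intro d a ha hli
  by_contra hlt
  obtain ⟨P₀, hP₀, hrel⟩ := exists_relation_of_not_le a hlt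
  obtain ⟨r₀, hr₀⟩ := hCM d a ha hli (3 * P₀.totalDegree)
  set r : ℕ := max r₀ 1 with hrdef
  obtain ⟨t, ht0, ht1, hsing⟩ := hE r (le_max_right _ _)
  obtain ⟨-, hα⟩ := hA r (le_max_right _ _) t ht0 ht1 hsing
  have hCMr := hr₀ r (le_max_left _ _) t ht0 ht1 hsing
  set F : ℝ := ∑' n : ℕ, ((Nat.centralBinom n : ℝ) / 4 ^ n) ^ 2 * t ^ n with hFdef
  set G : ℝ := ∑' n : ℕ, -(((Nat.centralBinom n : ℝ) / 4 ^ n) ^ 2 / (2 * (n : ℝ) - 1)) * t ^ n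
    with hGdef
  have hFpos : 0 < F := one_pos.trans_le (one_le_F ht0.le ht1)
  set αr : ℝ := (1 / Real.pi - Real.sqrt r * (F * G - F ^ 2)) / F ^ 2 with hαrdef
  -- Legendre's relation in Ramanujan–Borwein form holds by the definition of `α(r)`
  have hleg : Real.pi * (αr * F ^ 2 + Real.sqrt r * (F * G - F ^ 2)) = 1 := by
    rw [hαrdef, div_mul_cancel₀ _ (pow_ne_zero 2 hFpos.ne'), sub_add_cancel,
      mul_one_div_cancel Real.pi_ne_zero]
  have hlegC : (Real.pi : ℂ) * ((αr : ℂ) * (F : ℂ) ^ 2 +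
      (Real.sqrt r : ℂ) * ((F : ℂ) * (G : ℂ) - (F : ℂ) ^ 2)) = 1 := by
    exact_mod_cast congrArg (fun z : ℝ => (z : ℂ)) hleg
  have hαC : IsAlgebraic ℚ (αr : ℂ) := by
    simpa using hα.algHom Complex.ofRealHom.toRatAlgHom
  have hβC : IsAlgebraic ℚ ((Real.sqrt r : ℝ) : ℂ) := by
    refine IsAlgebraic.of_pow two_pos ?_
    rw [← Complex.ofReal_pow, Real.sq_sqrt (Nat.cast_nonneg r)]
    exact_mod_cast isAlgebraic_algebraMap (R := ℚ) (A := ℂ) (r : ℚ)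
  obtain ⟨Q, hQ0, hQalg, hQdeg, hQeval⟩ :=
    transfer (Complex.exp ∘ a) (Real.pi : ℂ) (F : ℂ) (G : ℂ) (αr : ℂ) (Real.sqrt r : ℂ) hαC hβC
      hlegC P₀ hP₀ hrel
  exact hCMr Q hQ0 hQalg hQdeg hQeval

/-- The crux along this line MODULO exactly the three registered stubs (depends on `sorryAx`
only through `stub_*`). -/
theorem PiFreeOverLWField_proof : PiFreeOverLWField :=
  PiFreeOverLWField_of stub_cmBoundedDegreeFreeness stub_singularModulusExists
    stub_singularValuesAlgebraic

/-- The same composition with the route's decls BY NAME as hypotheses: this is the support item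
`SingularModulusScaling.PiFreeOfCMFreeness` (stmt-Schanuel-17195), sorry-free — a candidate proof
for a prover to land in `Theorems/`. [folklore] -/
theorem piFreeOfCMFreeness : PiFreeOfCMFreeness :=
  fun h₁ h₂ h₃ => PiFreeOverLWField_of h₁ h₂ h₃

/-! ### The shared item under the sibling route's byte-identical decl -/

/-- Sorry-free composition concluding route `GaussianStokesSector`'s copy of the shared crux
(stmt-Schanuel-9545 is wanted there at rank 5). [folklore] -/
theorem PiFreeOverLWField_ofGaussianStokesSector (hCM : Statement.stub_cmBoundedDegreeFreeness)
    (hE : Statement.stub_singularModulusExists) (hA : Statement.stub_singularValuesAlgebraic) :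
    Summit.Schanuel.Schanuel.Theses.GaussianStokesSector.PiFreeOverLWField :=
  fun d a ha hli => PiFreeOverLWField_of hCM hE hA d a ha hli

/-- Route `GaussianStokesSector`'s decl of the shared crux MODULO the three registered stubs. -/
theorem PiFreeOverLWField_proofGaussianStokesSector :
    Summit.Schanuel.Schanuel.Theses.GaussianStokesSector.PiFreeOverLWField :=
  fun d a ha hli => PiFreeOverLWField_proof d a ha hli

end Summit.Schanuel.Schanuel.Cruxes.PiFreeOverLWField.Birth

end
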